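import Literature.Topology.FourManifolds.GaussDiagramsReadUnique
import Literature.Topology.FourManifolds.GaussDiagramsReadOff
import Literature.Topology.FourManifolds.GluckTwistTransport
import Literature.Topology.FourManifolds.Isotopy
import Mathlib.Analysis.Calculus.ImplicitFunction.ProdDomain
import HarnessLib

/-!
# Path constancy of the Gauss diagram along a generic ambient isotopy

Topic `Literature/Topology/FourManifolds`; a brick of the Reidemeister-type arguments for Gauss
diagrams of smooth knots (`GaussDiagrams.lean`: `Knot.RegularProjection`, `Knot.HasGaussDiagram`,
`GaussDiagram.IsRelabelling`; `GaussDiagramsReadOff.lean`: the Gauss diagram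
`Knot.InGeneralPosition.gaussDiagram` read off a knot in general position). The main results are

* `AmbientIsotopy.eventually_hasGaussDiagram_map` — **stability of regular projections**: if the
  knot `K` moved by the stage `F t₀` of an ambient isotopy `F` of `𝕊 3` admits a regular
  projection reading the Gauss diagram `G`, then for all times `t` near `t₀` the moved knot
  `F t ∘ K` admits a regular projection reading *the same* based, labelled Gauss diagram `G`
  (the crossings move continuously, none is created or destroyed, and over/under information and
  signs are kept);
* `AmbientIsotopy.eventually_isRelabelling_gaussDiagram` — **local constancy**: if `F t₀ ∘ K`
  is in general position (`Knot.InGeneralPosition`), then for `t` near `t₀` the Gauss diagrams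
  read off `F t₀ ∘ K` and `F t ∘ K` by `Knot.InGeneralPosition.gaussDiagram` are relabellings of
  each other (by the stability above and reading uniqueness,
  `Knot.RegularProjection.isRelabelling_diagram` of `GaussDiagramsReadUnique.lean`);
* `AmbientIsotopy.isRelabelling_gaussDiagram_of_forall_inGeneralPosition` — **path constancy**:
  if all the stages `F t ∘ K`, `t ∈ [a, b]`, of the moving knot are in general position, then
  the Gauss diagrams read off at the two ends differ only by a renumbering of the chords and a
  change of base point (`GaussDiagram.IsRelabelling`);
* `GaussDiagram.IsRelabelling.trans` — relabelling of Gauss diagrams is a transitive relation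
  (the combinatorial input of the globalisation).

This is the elementary half of Reidemeister's argument (Reidemeister (1932), Kap. I §1): the
projection scheme of a knot changes only when a deformation passes through a non-regular
position, so between two consecutive non-generic times of a generic isotopy the diagram does not
change. The generic immersions of the circle in the plane are stable (Whitney (1937)); the
combinatorial shadow recorded here is the based Gauss diagram of GPV (2000), §1.2.

## Proof sketch

Let `γ_t` be the stereographic plane curve of `K_t = F t ∘ K` (`Knot.planeCurve`), and `z_t` its
height function. The track `(t, θ) ↦ F t (K (cos θ, sin θ)) ∈ 𝕊 3 ⊆ ℝ⁴` is jointly smooth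
(`F` is a smooth isotopy), and the stereographic chart is smooth off the north pole, which `K_{t₀}`
misses; so `(t, θ) ↦ (γ_t θ, z_t θ)` is `C^∞` near `{t₀} × ℝ` (`contDiffAt_isoChart`).

1. *Continuation of crossings* (`exists_continuation`). At a transverse double point
   `(θ₁, θ₂)` of `γ_{t₀}` the map `(t, θ₁, θ₂) ↦ γ_t θ₁ - γ_t θ₂` has invertible partial
   differential in `(θ₁, θ₂)` (`doubleDiff`, `GaussDiagramsReadOff.lean`), so by the implicit
   function theorem (Mathlib's `HasStrictFDerivAt.implicitFunctionOfProdDomain`) the double point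
   continues uniquely and continuously in `t`, and near `(t₀, θ₁, θ₂)` the double points of `γ_t`
   are exactly the continued ones.
2. *Uniform local injectivity* (`eventually_eq_of_gam_eq`). Since `γ_{t₀}` is an immersion and
   `(t, θ) ↦ γ_t θ` is strictly differentiable, `γ_t` is injective near `θ₀` uniformly for `t` near
   `t₀`.
3. *No new crossings* (`eventually_eq_or_crossing`). Every pair of parameters `(s, u)` in the
   compact period square has a neighbourhood in `(t, s, u)`-space in which the double points of
   `γ_t` are either trivial (`s ≡ u`), by 2, or the continued crossings, by 1 and the axiom
   `eq_or_crossing` of the regular projection at time `t₀`; by compactness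
   (`IsCompact.eventually_forall_of_forall_eventually`) this holds for all `(s, u)` at once for `t`
   near `t₀`, and by `2π`-periodicity for all real `(s, u)`.
4. *The remaining axioms are open conditions* (`eventually_hasGaussDiagram_map`): the continued
   parameters stay strictly increasing and within one period, the knot stays off the north pole and
   its projection stays immersed (compactness of the circle), the height differences at the
   crossings and the determinants `det (γ_t'(over), γ_t'(under))` stay non-zero with the same signs
   (continuity); so the continued parameters together with the *same* Gauss diagram form a regular
   projection of `K_t`.
5. *Path constancy.* By reading uniqueness (`Knot.RegularProjection.isRelabelling_diagram`,
   `GaussDiagramsReadUnique.lean`) the diagram read off `K_t` by general position is then a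
   relabelling of the one read off `K_{t₀}`, for `t` near `t₀`; the relation "the read diagrams are
   relabellings of each other" is transitive (`GaussDiagram.IsRelabelling.trans`) and locally
   satisfied on the connected interval `[a, b]`, hence satisfied by the two ends
   (`IsPreconnected.induction₂'`).

Everything here is proved; no named facts and no public definitions are introduced (the track,
its chart expression and the double-point map are private helpers).

## References

* K. Reidemeister, *Knotentheorie*, Ergebnisse der Mathematik 1, Springer (1932), Kap. I §1
  (regular projections; the diagram is unchanged by deformations avoiding singular positions).
  [Reidemeister1932]
* H. Whitney, *On regular closed curves in the plane*, Compositio Math. 4 (1937) 276–284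
  (generic immersions of the circle and their stability). [GuilleminPollack1974]
* M. Goussarov, M. Polyak, O. Viro, *Finite-type invariants of classical and virtual knots*,
  Topology 39 (2000) 1045–1068, §1.2 (based Gauss diagrams). [GPV2000]
* M. W. Hirsch, *Differential Topology*, GTM 33 (1976), §8.1 (ambient isotopies). [Hirsch1976]

## Design notes

`𝔼 n`, `𝕊 n` are local notation as in `Knots.lean`. The moved knot is `K.map (F.toDiffeomorph t)`
(`SphereEmbedding.map`, `GluckTwistTransport.lean`), whose value at `x` is `F.toFun t (K x)`
definitionally. No statement of another file is modified; no `sorry`.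
-/

open scoped Manifold ContDiff Topology
open Function Set Filter

noncomputable section

namespace Literature.Topology.FourManifolds

/-- Local notation: `𝔼 n` is the model Euclidean space `EuclideanSpace ℝ (Fin n)`. -/
local notation "𝔼 " n:arg => EuclideanSpace ℝ (Fin n)

/-- Local notation: `𝕊 n` is the unit sphere in `EuclideanSpace ℝ (Fin (n + 1))`. -/
local notation "𝕊 " n:arg => (Metric.sphere (0 : EuclideanSpace ℝ (Fin (n + 1))) 1)

attribute [local instance] fact_finrank_euclideanSpace_two fact_finrank_euclideanSpace_four

/-! ### Relabellings compose -/

namespace GaussDiagram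

/-- Two Gauss diagrams with the same number of chords, the same positions (as numbers) of all
passages and the same signs are equal (indices compared through their values, to avoid casts;
local copy of the extensionality lemma of `KhCurlRotate.lean`, not imported here). [folklore] -/
private theorem ext_of_val_pc {G₁ G₂ : GaussDiagram} (hn : G₁.n = G₂.n)
    (ho : ∀ (i : Fin G₁.n) (j : Fin G₂.n), (i : ℕ) = j → (G₁.overPos i : ℕ) = G₂.overPos j)
    (hu : ∀ (i : Fin G₁.n) (j : Fin G₂.n), (i : ℕ) = j → (G₁.underPos i : ℕ) = G₂.underPos j)
    (hs : ∀ (i : Fin G₁.n) (j : Fin G₂.n), (i : ℕ) = j → G₁.sign i = G₂.sign j) : G₁ = G₂ := by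
  obtain ⟨n₁, o₁, u₁, s₁, b₁⟩ := G₁
  obtain ⟨n₂, o₂, u₂, s₂, b₂⟩ := G₂
  simp only at hn
  subst hn
  have h1 : o₁ = o₂ := funext fun i ↦ Fin.ext (ho i i rfl)
  have h2 : u₁ = u₂ := funext fun i ↦ Fin.ext (hu i i rfl)
  have h3 : s₁ = s₂ := funext fun i ↦ hs i i rfl
  subst h1; subst h2; subst h3
  rfl

/-- **Changes of base point compose**: rotating by `k` and then by `l` positions is rotating by
`k + l` positions. GPV (2000), §1.2. [cite: GPV2000, §1.2] -/
private theorem rotate_rotate_pc (G : GaussDiagram) (k l : ℕ) :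
    (G.rotate k).rotate l = G.rotate (k + l) := by
  refine ext_of_val_pc rfl (fun i i' h ↦ ?_) (fun i i' h ↦ ?_) (fun i i' h ↦ ?_) <;>
    obtain rfl : i = i' := Fin.ext h
  · simp only [rotate_overPos, val_rotPos]
    show (((G.overPos i : ℕ) + k) % (2 * G.n) + l) % (2 * G.n) =
      ((G.overPos i : ℕ) + (k + l)) % (2 * G.n)
    rw [Nat.mod_add_mod, add_assoc]
  · simp only [rotate_underPos, val_rotPos]
    show (((G.underPos i : ℕ) + k) % (2 * G.n) + l) % (2 * G.n) =
      ((G.underPos i : ℕ) + (k + l)) % (2 * G.n)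
    rw [Nat.mod_add_mod, add_assoc]
  · rfl

/-- **Renumbering commutes with changes of base point**: renumbering the chords after a rotation
is rotating after the composite renumbering. [folklore] -/
private theorem relabel_rotate_relabel_pc (G : GaussDiagram) (σ : Equiv.Perm (Fin G.n)) (k : ℕ)
    (τ : Equiv.Perm (Fin G.n)) :
    ((G.relabel σ).rotate k).relabel τ = (G.relabel (τ.trans σ)).rotate k := by
  refine ext_of_val_pc rfl (fun i i' h ↦ ?_) (fun i i' h ↦ ?_) (fun i i' h ↦ ?_) <;>
    obtain rfl : i = i' := Fin.ext h <;> rfl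

/-- **Relabelling is transitive**: a renumbering-and-rotation of a renumbering-and-rotation is a
renumbering-and-rotation (rotations compose additively and commute with renumberings).
GPV (2000), §1.2. [cite: GPV2000, §1.2] -/
theorem IsRelabelling.trans {G₁ G₂ G₃ : GaussDiagram} (h₁ : G₁.IsRelabelling G₂)
    (h₂ : G₂.IsRelabelling G₃) : G₁.IsRelabelling G₃ := by
  obtain ⟨σ, k, rfl⟩ := h₁
  obtain ⟨τ, l, rfl⟩ := h₂
  refine ⟨τ.trans σ, k + l, ?_⟩
  rw [relabel_rotate_relabel_pc, rotate_rotate_pc]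
  rfl

end GaussDiagram

/-! ### The track of a knot along an ambient isotopy, read in the stereographic chart -/

namespace GaussDiagramsPathConstancy

variable (F : AmbientIsotopy (𝓡 3) (𝕊 3)) (K : Knot)

/-- The knot moved by the stage `F t` of the ambient isotopy (reducible shorthand for
`K.map (F.toDiffeomorph t)`). [folklore] -/
private abbrev slide (t : ℝ) : Knot := K.map (F.toDiffeomorph t)

/-- The **track** of the knot along the isotopy, in `ℝ⁴`: `(t, θ) ↦ F t (K (cos θ, sin θ))`.
[folklore] -/
private def isoTrack (p : ℝ × ℝ) : 𝔼 4 := ((F.toFun p.1 (K (circlePoint p.2)) : 𝕊 3) : 𝔼 4)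

/-- The moving point `(t, θ) ↦ F t (K (cos θ, sin θ)) ∈ 𝕊 3` is jointly smooth. [folklore] -/
private theorem contMDiff_slidePoint :
    ContMDiff 𝓘(ℝ, ℝ × ℝ) (𝓡 3) ∞ (fun p : ℝ × ℝ ↦ F.toFun p.1 (K (circlePoint p.2))) := by
  have hcp : ContMDiff 𝓘(ℝ, ℝ) (𝓡 1) ∞ circlePoint :=
    contDiff_coe_circlePoint.contMDiff.codRestrict_sphere fun θ ↦ (circlePoint θ).2
  have h1 : ContMDiff 𝓘(ℝ, ℝ × ℝ) (𝓘(ℝ, ℝ).prod (𝓡 3)) ∞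
      (fun p : ℝ × ℝ ↦ (p.1, K (circlePoint p.2))) :=
    contDiff_fst.contMDiff.prodMk (K.contMDiff.comp (hcp.comp contDiff_snd.contMDiff))
  exact F.contMDiff.comp h1

/-- **The track is jointly `C^∞`** (Hirsch (1976), §8.1: an isotopy is a smooth map of
`ℝ × M`). [cite: Hirsch1976, §8.1] -/
private theorem contDiff_isoTrack : ContDiff ℝ ∞ (isoTrack F K) :=
  contMDiff_iff_contDiff.1 (contMDiff_coe_sphere.comp (contMDiff_slidePoint F K))

/-- The moving point `(t, x) ↦ F t (K x)` is jointly continuous. [folklore] -/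
private theorem continuous_slideApply : Continuous (fun p : ℝ × (𝕊 1) ↦ F.toFun p.1 (K p.2)) :=
  F.contMDiff.continuous.comp (continuous_fst.prodMk (K.continuous.comp continuous_snd))

/-- The track read in the stereographic chart: `(t, θ) ↦ (γ_t θ, z_t θ)`, the chart curve
(`Knot.stereoCurve`) of the moved knot. [folklore] -/
private def isoChart (p : ℝ × ℝ) : (ℝ × ℝ) × ℝ := stereoNorthCoords (isoTrack F K p)

/-- The chart track at `(t, θ)` is the chart curve of the moved knot `K_t` at `θ`. [folklore] -/
private theorem isoChart_apply (t θ : ℝ) :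
    isoChart F K (t, θ) = Knot.stereoCurve (slide F K t) θ := rfl

/-- The **family of plane curves** `(t, θ) ↦ γ_t θ` of the moved knots. [folklore] -/
private def gam (p : ℝ × ℝ) : ℝ × ℝ := (isoChart F K p).1

/-- `gam (t, θ)` is the plane curve of `K_t` at `θ`. [folklore] -/
private theorem gam_apply (t θ : ℝ) : gam F K (t, θ) = Knot.planeCurve (slide F K t) θ := rfl

/-- The height function of `K_t` is the last chart coordinate of the track. [folklore] -/
private theorem heightCurve_slide (t θ : ℝ) :
    Knot.heightCurve (slide F K t) θ = (isoChart F K (t, θ)).2 := rfl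

/-- The plane curves of the family are `2π`-periodic. [folklore] -/
private theorem gam_add_int_mul (t x : ℝ) (m : ℤ) :
    gam F K (t, x + m * (2 * Real.pi)) = gam F K (t, x) :=
  (Knot.periodic_planeCurve (slide F K t)).int_mul m x

variable {F K}

/-- The chart track is `C^∞` at every `(t, θ)` at which the moving knot is off the north pole.
[folklore] -/
private theorem contDiffAt_isoChart {p : ℝ × ℝ}
    (hp : F.toFun p.1 (K (circlePoint p.2)) ≠ northPole) : ContDiffAt ℝ ∞ (isoChart F K) p :=
  (contDiffAt_stereoNorthCoords (apply_three_ne_one_of_ne_northPole hp)).comp p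
    (contDiff_isoTrack F K).contDiffAt

/-- The family of plane curves is `C^∞` at every `(t, θ)` at which the moving knot is off the
north pole. [folklore] -/
private theorem contDiffAt_gam {p : ℝ × ℝ} (hp : F.toFun p.1 (K (circlePoint p.2)) ≠ northPole) :
    ContDiffAt ℝ ∞ (gam F K) p :=
  contDiffAt_fst.comp p (contDiffAt_isoChart hp)

variable {t₀ : ℝ}

/-- If `K_{t₀}` misses the north pole, so does the moving point near `(t₀, θ)`. [folklore] -/
private theorem eventually_ne_northPole (h₀ : ∀ x, slide F K t₀ x ≠ northPole) (θ : ℝ) :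
    ∀ᶠ p in 𝓝 (t₀, θ), F.toFun p.1 (K (circlePoint p.2)) ≠ northPole :=
  ((contMDiff_slidePoint F K).continuous.continuousAt).eventually_ne (h₀ (circlePoint θ))

/-- **Missing the north pole is an open condition** (the circle is compact). [folklore] -/
private theorem eventually_forall_ne_northPole (h₀ : ∀ x, slide F K t₀ x ≠ northPole) :
    ∀ᶠ t in 𝓝 t₀, ∀ x, slide F K t x ≠ northPole := by
  have := (isCompact_univ (X := 𝕊 1)).eventually_forall_of_forall_eventually
    (x₀ := t₀) (P := fun t x ↦ F.toFun t (K x) ≠ northPole) fun x _ ↦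
      ((continuous_slideApply F K).continuousAt).eventually_ne (h₀ x)
  filter_upwards [this] with t ht x using ht x (mem_univ x)

/-- The family of plane curves is `C^∞` near every point of the slice `t = t₀`. [folklore] -/
private theorem eventually_contDiffAt_gam (h₀ : ∀ x, slide F K t₀ x ≠ northPole) (θ : ℝ) :
    ∀ᶠ p in 𝓝 (t₀, θ), ContDiffAt ℝ ∞ (gam F K) p :=
  (eventually_ne_northPole h₀ θ).mono fun _ hp ↦ contDiffAt_gam hp

/-- The **family of velocities** `(t, θ) ↦ γ_t' θ` of the plane curves. [folklore] -/
private def dgam (F : AmbientIsotopy (𝓡 3) (𝕊 3)) (K : Knot) (p : ℝ × ℝ) : ℝ × ℝ :=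
  deriv (Knot.planeCurve (slide F K p.1)) p.2

/-- The velocity `γ_t' θ` is the partial derivative of the family in `θ` (chain rule). [folklore] -/
private theorem dgam_eq_fderiv {p : ℝ × ℝ} (hp : ContDiffAt ℝ ∞ (gam F K) p) :
    dgam F K p = fderiv ℝ (gam F K) p (0, 1) := by
  have h1 : HasFDerivAt (gam F K) (fderiv ℝ (gam F K) p) (p.1, p.2) :=
    (hp.differentiableAt (by simp)).hasFDerivAt
  have h2 : HasDerivAt (fun θ : ℝ ↦ (p.1, θ)) ((0 : ℝ), (1 : ℝ)) p.2 :=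
    (hasDerivAt_const p.2 p.1).prodMk (hasDerivAt_id p.2)
  exact (h1.comp_hasDerivAt p.2 h2).deriv

/-- **The velocities `γ_t' θ` depend continuously on `(t, θ)`** near the slice `t = t₀`.
[folklore] -/
private theorem continuousAt_dgam (h₀ : ∀ x, slide F K t₀ x ≠ northPole) (θ : ℝ) :
    ContinuousAt (dgam F K) (t₀, θ) := by
  have hc : ContinuousAt (fun p ↦ fderiv ℝ (gam F K) p ((0 : ℝ), (1 : ℝ))) (t₀, θ) :=
    ((contDiffAt_gam (h₀ _)).continuousAt_fderiv (by simp)).clm_apply continuousAt_const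
  refine hc.congr ?_
  filter_upwards [eventually_contDiffAt_gam h₀ θ] with p hp using (dgam_eq_fderiv hp).symm

/-- **Being immersed is an open condition**: if the projection of `K_{t₀}` is an immersion, so is
the projection of `K_t` for `t` near `t₀` (compactness of a period). [folklore] -/
private theorem eventually_deriv_ne_zero (h₀ : ∀ x, slide F K t₀ x ≠ northPole)
    (himm : ∀ θ, deriv (Knot.planeCurve (slide F K t₀)) θ ≠ 0) :
    ∀ᶠ t in 𝓝 t₀, ∀ θ, deriv (Knot.planeCurve (slide F K t)) θ ≠ 0 := by
  have := (isCompact_Icc (a := (0 : ℝ)) (b := 2 * Real.pi)).eventually_forall_of_forall_eventually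
    (x₀ := t₀) (P := fun t θ ↦ dgam F K (t, θ) ≠ 0) fun θ _ ↦
      (continuousAt_dgam h₀ θ).eventually_ne (himm θ)
  filter_upwards [this] with t ht θ
  obtain ⟨θ', hθ', -, k, hk⟩ := exists_mem_Ico_circlePoint_eq θ
  have hper := (periodic_deriv_of_periodic (Knot.periodic_planeCurve (slide F K t))).int_mul k θ
  have h1 : deriv (Knot.planeCurve (slide F K t)) θ' ≠ 0 := ht θ' (Ico_subset_Icc_self hθ')
  rwa [hk, hper] at h1

/-- **Uniform local injectivity of an immersed family.** If `γ_{t₀}' θ₀ ≠ 0` then for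
`(t, a, b)` near `(t₀, θ₀, θ₀)`, `γ_t a = γ_t b` forces `a = b`: by strict differentiability of
the family at `(t₀, θ₀)`, `‖γ_t a - γ_t b‖ ≥ ½ ‖γ_{t₀}' θ₀‖ |a - b|` there. [folklore] -/
private theorem eventually_eq_of_gam_eq (h₀ : ∀ x, slide F K t₀ x ≠ northPole) {θ₀ : ℝ}
    (himm : deriv (Knot.planeCurve (slide F K t₀)) θ₀ ≠ 0) :
    ∀ᶠ q in 𝓝 (t₀, θ₀, θ₀), gam F K (q.1, q.2.1) = gam F K (q.1, q.2.2) → q.2.1 = q.2.2 := by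
  have hsd : HasStrictFDerivAt (gam F K) (fderiv ℝ (gam F K) (t₀, θ₀)) (t₀, θ₀) :=
    (contDiffAt_gam (h₀ _)).hasStrictFDerivAt (by simp)
  set L := fderiv ℝ (gam F K) (t₀, θ₀) with hL
  have hv : L ((0 : ℝ), (1 : ℝ)) ≠ 0 := by
    rw [← dgam_eq_fderiv (contDiffAt_gam (h₀ _))]; exact himm
  set c := ‖L ((0 : ℝ), (1 : ℝ))‖ / 2 with hc
  have hc0 : 0 < c := by have := norm_pos_iff.2 hv; positivity
  have hO := hsd.isLittleO.def hc0
  have he : Tendsto (fun q : ℝ × ℝ × ℝ ↦ ((q.1, q.2.1), (q.1, q.2.2))) (𝓝 (t₀, θ₀, θ₀))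
      (𝓝 ((t₀, θ₀), (t₀, θ₀))) := Continuous.tendsto (by fun_prop) _
  filter_upwards [he.eventually hO] with q hq heq
  rw [heq, sub_self, zero_sub, norm_neg] at hq
  have hdiff : ((q.1, q.2.1) : ℝ × ℝ) - (q.1, q.2.2) = (q.2.1 - q.2.2) • ((0 : ℝ), (1 : ℝ)) := by
    ext <;> simp
  rw [hdiff, map_smul, norm_smul, norm_smul] at hq
  have h01 : ‖((0 : ℝ), (1 : ℝ))‖ = 1 := by simp [Prod.norm_def]
  rw [h01, mul_one, Real.norm_eq_abs] at hq
  by_contra hne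
  have hpos : 0 < |q.2.1 - q.2.2| := abs_pos.2 (sub_ne_zero.2 hne)
  have h2 : ‖L ((0 : ℝ), (1 : ℝ))‖ ≤ c := le_of_mul_le_mul_left (by linarith) hpos
  have h3 : 0 < ‖L ((0 : ℝ), (1 : ℝ))‖ := norm_pos_iff.2 hv
  linarith

/-! ### Continuation of transverse crossings (implicit function theorem) -/

/-- The **double-point map** of the family: `(t, (a, b)) ↦ γ_t a - γ_t b`. [folklore] -/
private def Phi (F : AmbientIsotopy (𝓡 3) (𝕊 3)) (K : Knot) (v : ℝ × (ℝ × ℝ)) : ℝ × ℝ :=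
  gam F K (v.1, v.2.1) - gam F K (v.1, v.2.2)

/-- The double-point map is `C^∞` where the family is. [folklore] -/
private theorem contDiffAt_Phi {v : ℝ × (ℝ × ℝ)} (h1 : ContDiffAt ℝ ∞ (gam F K) (v.1, v.2.1))
    (h2 : ContDiffAt ℝ ∞ (gam F K) (v.1, v.2.2)) : ContDiffAt ℝ ∞ (Phi F K) v :=
  (h1.comp v (contDiff_fst.prodMk (contDiff_fst.comp contDiff_snd)).contDiffAt).sub
    (h2.comp v (contDiff_fst.prodMk (contDiff_snd.comp contDiff_snd)).contDiffAt)

/-- **The partial differential of the double-point map in `(a, b)` is `doubleDiff γ_{t₀}`**, the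
differential `(α, β) ↦ α γ_{t₀}'(a) - β γ_{t₀}'(b)` of `GaussDiagramsReadOff.lean`. [folklore] -/
private theorem fderiv_Phi_comp_inr (h₀ : ∀ x, slide F K t₀ x ≠ northPole) (p₀ : ℝ × ℝ) :
    (fderiv ℝ (Phi F K) (t₀, p₀)).comp (ContinuousLinearMap.inr ℝ ℝ (ℝ × ℝ)) =
      doubleDiff (Knot.planeCurve (slide F K t₀)) p₀ := by
  have hΦ : ContDiffAt ℝ ∞ (Phi F K) (t₀, p₀) :=
    contDiffAt_Phi (contDiffAt_gam (h₀ _)) (contDiffAt_gam (h₀ _))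
  have h1 : HasFDerivAt (Phi F K) (fderiv ℝ (Phi F K) (t₀, p₀)) (t₀, p₀) :=
    (hΦ.differentiableAt (by simp)).hasFDerivAt
  have h2 : HasFDerivAt (fun q : ℝ × ℝ ↦ ((t₀, q) : ℝ × (ℝ × ℝ)))
      (ContinuousLinearMap.inr ℝ ℝ (ℝ × ℝ)) p₀ := hasFDerivAt_prodMk_right t₀ p₀
  have h3 := h1.comp p₀ h2
  have h4 : HasFDerivAt (fun q : ℝ × ℝ ↦ Knot.planeCurve (slide F K t₀) q.1 -
      Knot.planeCurve (slide F K t₀) q.2) (doubleDiff _ p₀) p₀ :=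
    (hasStrictFDerivAt_doubleDiff (Knot.contDiff_planeCurve h₀) p₀).hasFDerivAt
  exact h3.unique h4

/-- At a transverse double point `doubleDiff` is invertible. [folklore] -/
private theorem isInvertible_doubleDiff {γ : ℝ → ℝ × ℝ} {p : ℝ × ℝ}
    (hc : cross (deriv γ p.1) (deriv γ p.2) ≠ 0) : (doubleDiff γ p).IsInvertible := by
  have hinj := doubleDiff_injective hc
  have hker : LinearMap.ker (doubleDiff γ p : ℝ × ℝ →ₗ[ℝ] ℝ × ℝ) = ⊥ :=
    LinearMap.ker_eq_bot.2 hinj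
  have hrange : LinearMap.range (doubleDiff γ p : ℝ × ℝ →ₗ[ℝ] ℝ × ℝ) = ⊤ :=
    LinearMap.range_eq_top.2 (LinearMap.injective_iff_surjective.1 hinj)
  exact ⟨ContinuousLinearEquiv.ofBijective (doubleDiff γ p) hker hrange,
    ContinuousLinearEquiv.coe_ofBijective _ _ _⟩

/-- **Continuation of a transverse crossing** (implicit function theorem). A transverse double
point `p₀ = (a, b)` of `γ_{t₀}` continues to a double point `ψ t` of `γ_t` depending continuously
on `t` near `t₀`, with `ψ t₀ = p₀`, and near `(t₀, p₀)` the double points of the family are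
exactly the points `(t, ψ t)`. Whitney (1937) (stability of generic immersions); the
parametric form of `exists_nhds_injOn_of_cross_ne_zero` (`GaussDiagramsReadOff.lean`).
[cite: GuilleminPollack1974, Ch. 1 §5] -/
private theorem exists_continuation (h₀ : ∀ x, slide F K t₀ x ≠ northPole) {p₀ : ℝ × ℝ}
    (hd : Knot.planeCurve (slide F K t₀) p₀.1 = Knot.planeCurve (slide F K t₀) p₀.2)
    (hc : cross (deriv (Knot.planeCurve (slide F K t₀)) p₀.1)
      (deriv (Knot.planeCurve (slide F K t₀)) p₀.2) ≠ 0) :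
    ∃ ψ : ℝ → ℝ × ℝ, ψ t₀ = p₀ ∧ Tendsto ψ (𝓝 t₀) (𝓝 p₀) ∧
      (∀ᶠ t in 𝓝 t₀, gam F K (t, (ψ t).1) = gam F K (t, (ψ t).2)) ∧
      ∀ᶠ v in 𝓝 (t₀, p₀), gam F K (v.1, v.2.1) = gam F K (v.1, v.2.2) → ψ v.1 = v.2 := by
  have hΦ : ContDiffAt ℝ ∞ (Phi F K) (t₀, p₀) :=
    contDiffAt_Phi (contDiffAt_gam (h₀ _)) (contDiffAt_gam (h₀ _))
  have hsd : HasStrictFDerivAt (Phi F K) (fderiv ℝ (Phi F K) (t₀, p₀)) (t₀, p₀) :=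
    hΦ.hasStrictFDerivAt (by simp)
  have hinv : ((fderiv ℝ (Phi F K) (t₀, p₀)).comp
      (ContinuousLinearMap.inr ℝ ℝ (ℝ × ℝ))).IsInvertible := by
    rw [fderiv_Phi_comp_inr h₀]; exact isInvertible_doubleDiff hc
  have hzero : Phi F K (t₀, p₀) = 0 := sub_eq_zero.2 hd
  have hiff := hsd.eventually_apply_eq_iff_implicitFunctionOfProdDomain hinv
  refine ⟨hsd.implicitFunctionOfProdDomain hinv, (hiff.self_of_nhds).1 rfl,
    hsd.tendsto_implicitFunctionOfProdDomain hinv, ?_, ?_⟩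
  · filter_upwards [hsd.eventually_apply_implicitFunctionOfProdDomain hinv] with t ht
    rw [hzero] at ht
    exact sub_eq_zero.1 ht
  · filter_upwards [hiff] with v hv heq
    rw [hzero] at hv
    exact hv.1 (sub_eq_zero.2 heq)

/-! ### No crossing is created: the double points near `t₀` are the continued ones -/

/-- **No new crossings.** Let `P₀` be a regular projection of `K_{t₀}` and, for every chord `i`,
let `ψ i` be a continuation of its crossing with the uniqueness property of
`exists_continuation`. Then for `t` near `t₀` every double point `γ_t s = γ_t u` of the moved
knot is trivial (`s ≡ u (mod 2π)`) or is, modulo `2π`, one of the continued crossings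
`ψ i t`: each pair `(s, u)` of the compact period square has a neighbourhood in `(t, s, u)` where
this holds — by continuity if `γ_{t₀} s ≠ γ_{t₀} u`, by uniform local injectivity if `s ≡ u`, by
the uniqueness clause of the implicit function theorem at the crossing given by
`P₀.eq_or_crossing` otherwise — and finitely many such neighbourhoods cover the square
(`IsCompact.eventually_forall_of_forall_eventually`). Reidemeister (1932), Kap. I §1;
Whitney (1937). [cite: Reidemeister1932, Kap. I §1] -/
private theorem eventually_eq_or_crossing (P₀ : Knot.RegularProjection (slide F K t₀))
    (ψ : Fin P₀.diagram.n → ℝ → ℝ × ℝ)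
    (hψu : ∀ i, ∀ᶠ v in 𝓝 (t₀, (P₀.θ (P₀.diagram.overPos i), P₀.θ (P₀.diagram.underPos i))),
      gam F K (v.1, v.2.1) = gam F K (v.1, v.2.2) → ψ i v.1 = v.2) :
    ∀ᶠ t in 𝓝 t₀, ∀ s u, gam F K (t, s) = gam F K (t, u) →
      (∃ k : ℤ, u = s + k * (2 * Real.pi)) ∨
        ∃ (i : Fin P₀.diagram.n) (k l : ℤ),
          ({s + k * (2 * Real.pi), u + l * (2 * Real.pi)} : Set ℝ) = {(ψ i t).1, (ψ i t).2} := by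
  have h₀ : ∀ x, slide F K t₀ x ≠ northPole := fun x hx ↦ P₀.northPole_notMem ⟨x, hx⟩
  have hper := gam_add_int_mul F K
  -- the local statement near every pair of parameters
  have key : ∀ q : ℝ × ℝ, ∀ᶠ z in 𝓝 (t₀, q), gam F K (z.1, z.2.1) = gam F K (z.1, z.2.2) →
      (∃ k : ℤ, z.2.2 = z.2.1 + k * (2 * Real.pi)) ∨
        ∃ (i : Fin P₀.diagram.n) (k l : ℤ),
          ({z.2.1 + k * (2 * Real.pi), z.2.2 + l * (2 * Real.pi)} : Set ℝ) =
            {(ψ i z.1).1, (ψ i z.1).2} := by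
    rintro ⟨s, u⟩
    by_cases hsu : gam F K (t₀, s) = gam F K (t₀, u)
    · rcases P₀.eq_or_crossing s u hsu with ⟨k, hk⟩ | ⟨i, k, l, hkl⟩
      · -- a trivial double point: uniform local injectivity near `(t₀, s, s)`
        have hR := eventually_eq_of_gam_eq h₀ (P₀.deriv_ne_zero s)
        have he : Tendsto (fun z : ℝ × ℝ × ℝ ↦ (z.1, z.2.1, z.2.2 + ((-k : ℤ) : ℝ) * (2 * Real.pi)))
            (𝓝 (t₀, s, u)) (𝓝 (t₀, s, s)) := by
          have : ((t₀, s, u + ((-k : ℤ) : ℝ) * (2 * Real.pi)) : ℝ × ℝ × ℝ) = (t₀, s, s) :=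
            Prod.ext rfl (Prod.ext rfl (by rw [hk]; push_cast; ring))
          rw [← this]
          exact Continuous.tendsto (by fun_prop) _
        filter_upwards [he.eventually hR] with z hz heq
        refine Or.inl ⟨k, ?_⟩
        have := hz (by rw [hper]; exact heq)
        rw [this]; push_cast; ring
      · rcases Set.pair_eq_pair_iff.1 hkl with ⟨h1, h2⟩ | ⟨h1, h2⟩
        · -- `s` continues the over-passage, `u` the under-passage of chord `i`
          have he : Tendsto (fun z : ℝ × ℝ × ℝ ↦
              (z.1, (z.2.1 + k * (2 * Real.pi), z.2.2 + l * (2 * Real.pi))))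
              (𝓝 (t₀, s, u)) (𝓝 (t₀, (P₀.θ (P₀.diagram.overPos i),
                P₀.θ (P₀.diagram.underPos i)))) := by
            rw [← h1, ← h2]
            exact Continuous.tendsto (by fun_prop) _
          filter_upwards [he.eventually (hψu i)] with z hz heq
          refine Or.inr ⟨i, k, l, ?_⟩
          have := hz (by rw [hper, hper]; exact heq)
          rw [this]
        · -- `u` continues the over-passage, `s` the under-passage of chord `i`
          have he : Tendsto (fun z : ℝ × ℝ × ℝ ↦
              (z.1, (z.2.2 + l * (2 * Real.pi), z.2.1 + k * (2 * Real.pi))))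
              (𝓝 (t₀, s, u)) (𝓝 (t₀, (P₀.θ (P₀.diagram.overPos i),
                P₀.θ (P₀.diagram.underPos i)))) := by
            rw [← h1, ← h2]
            exact Continuous.tendsto (by fun_prop) _
          filter_upwards [he.eventually (hψu i)] with z hz heq
          refine Or.inr ⟨i, k, l, ?_⟩
          have := hz (by rw [hper, hper]; exact heq.symm)
          rw [this, Set.pair_comm]
    · -- not a double point at time `t₀`: still not one nearby
      have hc : ContinuousAt (fun z : ℝ × ℝ × ℝ ↦ gam F K (z.1, z.2.1) - gam F K (z.1, z.2.2))
          (t₀, s, u) :=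
        ((contDiffAt_gam (h₀ _)).continuousAt.comp (by fun_prop : Continuous
          fun z : ℝ × ℝ × ℝ ↦ (z.1, z.2.1)).continuousAt).sub
          ((contDiffAt_gam (h₀ _)).continuousAt.comp (by fun_prop : Continuous
          fun z : ℝ × ℝ × ℝ ↦ (z.1, z.2.2)).continuousAt)
      filter_upwards [hc.eventually_ne (sub_ne_zero.2 hsu)] with z hz heq
      exact absurd (sub_eq_zero.2 heq) hz
  -- compactness of the period square
  have hsq := ((isCompact_Icc (a := (0 : ℝ)) (b := 2 * Real.pi)).prod
    (isCompact_Icc (a := (0 : ℝ)) (b := 2 * Real.pi))).eventually_forall_of_forall_eventually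
    (x₀ := t₀) (P := fun t q ↦ gam F K (t, q.1) = gam F K (t, q.2) →
      (∃ k : ℤ, q.2 = q.1 + k * (2 * Real.pi)) ∨
        ∃ (i : Fin P₀.diagram.n) (k l : ℤ),
          ({q.1 + k * (2 * Real.pi), q.2 + l * (2 * Real.pi)} : Set ℝ) =
            {(ψ i t).1, (ψ i t).2}) fun q _ ↦ key q
  -- periodicity
  filter_upwards [hsq] with t ht s u hsu
  obtain ⟨s', hs', -, k₁, hk₁⟩ := exists_mem_Ico_circlePoint_eq s
  obtain ⟨u', hu', -, k₂, hk₂⟩ := exists_mem_Ico_circlePoint_eq u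
  have h' : gam F K (t, s') = gam F K (t, u') := by rw [hk₁, hk₂, hper, hper]; exact hsu
  rcases ht (s', u') ⟨Ico_subset_Icc_self hs', Ico_subset_Icc_self hu'⟩ h' with
    ⟨k, hk⟩ | ⟨i, k, l, hkl⟩
  · refine Or.inl ⟨k + k₁ - k₂, ?_⟩
    simp only at hk
    rw [hk₁, hk₂] at hk
    push_cast
    linarith
  · refine Or.inr ⟨i, k + k₁, l + k₂, ?_⟩
    simp only at hkl
    rw [← hkl, hk₁, hk₂]
    push_cast
    rw [show s + k₁ * (2 * Real.pi) + k * (2 * Real.pi) = s + (k + k₁) * (2 * Real.pi) by ring,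
      show u + k₂ * (2 * Real.pi) + l * (2 * Real.pi) = u + (l + k₂) * (2 * Real.pi) by ring]

/-! ### Stability of regular projections -/

/-- **Stability of regular projections along an isotopy** (helper form, for the reducible
shorthand `slide`). If `K_{t₀}` admits the regular projection `P₀`, then for `t` near `t₀` the
moved knot `K_t` admits a regular projection reading the *same* Gauss diagram: its parameters are
the continued crossings (`exists_continuation`), which stay increasing within one period, its
double points are the continued crossings only (`eventually_eq_or_crossing`), the knot stays off
the pole and immersed (`eventually_forall_ne_northPole`, `eventually_deriv_ne_zero`), and the
height order at each crossing and the sign of each crossing persist by continuity.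
Reidemeister (1932), Kap. I §1; Whitney (1937). [cite: Reidemeister1932, Kap. I §1] -/
private theorem eventually_hasGaussDiagram_slide (P₀ : Knot.RegularProjection (slide F K t₀)) :
    ∀ᶠ t in 𝓝 t₀, Knot.HasGaussDiagram (slide F K t) P₀.diagram := by
  have h₀ : ∀ x, slide F K t₀ x ≠ northPole := fun x hx ↦ P₀.northPole_notMem ⟨x, hx⟩
  set G := P₀.diagram
  -- the crossings of `P₀` and their continuations
  set a : Fin G.n → ℝ := fun i ↦ P₀.θ (G.overPos i)
  set b : Fin G.n → ℝ := fun i ↦ P₀.θ (G.underPos i)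
  have hcross : ∀ i, cross (deriv (Knot.planeCurve (slide F K t₀)) (a i))
      (deriv (Knot.planeCurve (slide F K t₀)) (b i)) ≠ 0 := fun i ↦ by
    rw [cross_eq_det]; exact P₀.det_ne_zero i
  have hcont := fun i ↦ exists_continuation h₀ (p₀ := (a i, b i)) (P₀.double i) (hcross i)
  choose ψ hψ₀ hψt hψd hψu using hcont
  -- the continued parameters, position by position
  set Θ : ℝ → Fin (2 * G.n) → ℝ := fun t p ↦
    Sum.elim (fun i ↦ (ψ i t).1) (fun i ↦ (ψ i t).2) (G.endEquiv.symm p) with hΘ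
  have hΘo : ∀ t i, Θ t (G.overPos i) = (ψ i t).1 := fun t i ↦ by
    simp only [hΘ]
    rw [show G.endEquiv.symm (G.overPos i) = Sum.inl i from G.endEquiv.symm_apply_eq.2 rfl]
    rfl
  have hΘu : ∀ t i, Θ t (G.underPos i) = (ψ i t).2 := fun t i ↦ by
    simp only [hΘ]
    rw [show G.endEquiv.symm (G.underPos i) = Sum.inr i from G.endEquiv.symm_apply_eq.2 rfl]
    rfl
  have hΘt : ∀ p, Tendsto (fun t ↦ Θ t p) (𝓝 t₀) (𝓝 (P₀.θ p)) := fun p ↦ by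
    obtain ⟨i, rfl | rfl⟩ := G.exists_chord p
    · rw [show (fun t ↦ Θ t (G.overPos i)) = fun t ↦ (ψ i t).1 from funext fun t ↦ hΘo t i]
      exact (continuous_fst.tendsto _).comp (hψt i)
    · rw [show (fun t ↦ Θ t (G.underPos i)) = fun t ↦ (ψ i t).2 from funext fun t ↦ hΘu t i]
      exact (continuous_snd.tendsto _).comp (hψt i)
  -- the moving crossings, as points of the `(t, θ)` plane
  have hmo : ∀ i, Tendsto (fun t ↦ (t, (ψ i t).1)) (𝓝 t₀) (𝓝 (t₀, a i)) := fun i ↦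
    tendsto_id.prodMk_nhds ((continuous_fst.tendsto _).comp (hψt i))
  have hmu : ∀ i, Tendsto (fun t ↦ (t, (ψ i t).2)) (𝓝 t₀) (𝓝 (t₀, b i)) := fun i ↦
    tendsto_id.prodMk_nhds ((continuous_snd.tendsto _).comp (hψt i))
  -- (1) the parameters stay strictly increasing
  have E1 : ∀ᶠ t in 𝓝 t₀, ∀ p q, p < q → Θ t p < Θ t q := by
    refine eventually_all.2 fun p ↦ eventually_all.2 fun q ↦ ?_
    by_cases hpq : p < q
    · exact ((hΘt p).eventually_lt (hΘt q) (P₀.strictMono hpq)).mono fun t ht _ ↦ ht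
    · exact Eventually.of_forall fun t h ↦ absurd h hpq
  -- (2) and within one period
  have E2 : ∀ᶠ t in 𝓝 t₀, ∀ p q, Θ t p < Θ t q + 2 * Real.pi :=
    eventually_all.2 fun p ↦ eventually_all.2 fun q ↦
      (hΘt p).eventually_lt ((hΘt q).add_const _) (P₀.lt_add_two_pi p q)
  -- (3) the continued crossings are double points
  have E3 : ∀ᶠ t in 𝓝 t₀, ∀ i, gam F K (t, Θ t (G.overPos i)) = gam F K (t, Θ t (G.underPos i)) :=
    eventually_all.2 fun i ↦ (hψd i).mono fun t ht ↦ by rw [hΘo, hΘu]; exact ht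
  -- (4) the over-passage stays above the under-passage
  have E4 : ∀ᶠ t in 𝓝 t₀, ∀ i, Knot.heightCurve (slide F K t) (Θ t (G.underPos i)) <
      Knot.heightCurve (slide F K t) (Θ t (G.overPos i)) := by
    refine eventually_all.2 fun i ↦ ?_
    have hO : Tendsto (fun t ↦ Knot.heightCurve (slide F K t) (ψ i t).1) (𝓝 t₀)
        (𝓝 (Knot.heightCurve (slide F K t₀) (a i))) :=
      (continuous_snd.tendsto _).comp ((contDiffAt_isoChart (h₀ _)).continuousAt.tendsto.comp
        (hmo i))
    have hU : Tendsto (fun t ↦ Knot.heightCurve (slide F K t) (ψ i t).2) (𝓝 t₀)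
        (𝓝 (Knot.heightCurve (slide F K t₀) (b i))) :=
      (continuous_snd.tendsto _).comp ((contDiffAt_isoChart (h₀ _)).continuousAt.tendsto.comp
        (hmu i))
    exact (hU.eventually_lt hO (P₀.heightCurve_lt i)).mono fun t ht ↦ by rwa [hΘo, hΘu]
  -- (5) the signs persist
  have E5 : ∀ᶠ t in 𝓝 t₀, ∀ i,
      SignType.sign (cross (deriv (Knot.planeCurve (slide F K t)) (Θ t (G.overPos i)))
        (deriv (Knot.planeCurve (slide F K t)) (Θ t (G.underPos i)))) =
      SignType.sign (cross (deriv (Knot.planeCurve (slide F K t₀)) (a i))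
        (deriv (Knot.planeCurve (slide F K t₀)) (b i))) := by
    refine eventually_all.2 fun i ↦ ?_
    have hcc : Continuous (fun w : (ℝ × ℝ) × (ℝ × ℝ) ↦ cross w.1 w.2) := by
      unfold cross; fun_prop
    have hT : Tendsto (fun t ↦ cross (dgam F K (t, (ψ i t).1)) (dgam F K (t, (ψ i t).2)))
        (𝓝 t₀) (𝓝 (cross (dgam F K (t₀, a i)) (dgam F K (t₀, b i)))) :=
      (hcc.tendsto _).comp (((continuousAt_dgam h₀ _).tendsto.comp (hmo i)).prodMk_nhds
        ((continuousAt_dgam h₀ _).tendsto.comp (hmu i)))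
    have hne : cross (dgam F K (t₀, a i)) (dgam F K (t₀, b i)) ≠ 0 := hcross i
    rcases lt_or_gt_of_ne hne with hlt | hgt
    · filter_upwards [hT.eventually_lt_const hlt] with t ht
      rw [hΘo, hΘu]
      change SignType.sign (cross (dgam F K (t, (ψ i t).1)) (dgam F K (t, (ψ i t).2))) =
        SignType.sign (cross (dgam F K (t₀, a i)) (dgam F K (t₀, b i)))
      rw [sign_neg ht, sign_neg hlt]
    · filter_upwards [hT.eventually_const_lt hgt] with t ht
      rw [hΘo, hΘu]
      change SignType.sign (cross (dgam F K (t, (ψ i t).1)) (dgam F K (t, (ψ i t).2))) =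
        SignType.sign (cross (dgam F K (t₀, a i)) (dgam F K (t₀, b i)))
      rw [sign_pos ht, sign_pos hgt]
  -- (6) off the pole, (7) immersed, (8) no new crossings
  have E6 := eventually_forall_ne_northPole h₀
  have E7 := eventually_deriv_ne_zero h₀ P₀.deriv_ne_zero
  have E8 := eventually_eq_or_crossing P₀ ψ hψu
  filter_upwards [E1, E2, E3, E4, E5, E6, E7, E8] with t h1 h2 h3 h4 h5 h6 h7 h8
  refine ⟨⟨G, Θ t, fun p q hpq ↦ h1 p q hpq, h2, fun ⟨x, hx⟩ ↦ h6 x hx, h7, h3, fun s u hsu ↦ ?_,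
    h4, fun i ↦ ?_⟩, rfl⟩
  · rcases h8 s u hsu with hk | ⟨i, k, l, hkl⟩
    · exact Or.inl hk
    · exact Or.inr ⟨i, k, l, by rw [hΘo, hΘu]; exact hkl⟩
  · rw [← cross_eq_det, h5 i, P₀.sign_eq i, ← cross_eq_det]

end GaussDiagramsPathConstancy

open GaussDiagramsPathConstancy in
/-- **Stability of regular projections along an ambient isotopy.** Let `F` be an ambient isotopy
of `𝕊 3`, `K` a knot, and suppose that the moved knot `F t₀ ∘ K` admits a regular projection `P₀`
(stereographic projection from the north pole, `Knot.RegularProjection`). Then for all `t` near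
`t₀` the moved knot `F t ∘ K` admits a regular projection reading the same based, labelled Gauss
diagram `P₀.diagram`: the crossings continue continuously (implicit function theorem at the
transverse double points), no crossing is created (compactness and uniform local injectivity),
and the cyclic order, the over/under information and the signs persist (open conditions).
Reidemeister (1932), Kap. I §1 (the projection scheme does not change as long as no singular
position is crossed); Whitney (1937) (stability of generic immersions); GPV (2000), §1.2.
[cite: Reidemeister1932, Kap. I §1] -/
theorem AmbientIsotopy.eventually_hasGaussDiagram_map (F : AmbientIsotopy (𝓡 3) (𝕊 3))
    (K : Knot) {t₀ : ℝ} (P₀ : Knot.RegularProjection (K.map (F.toDiffeomorph t₀))) :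
    ∀ᶠ t in 𝓝 t₀, Knot.HasGaussDiagram (K.map (F.toDiffeomorph t)) P₀.diagram :=
  eventually_hasGaussDiagram_slide P₀

/-- **Local constancy of the read Gauss diagram.** If `F t₀ ∘ K` is in general position, then for
`t` near `t₀` and any general-position witnesses, the Gauss diagrams read off `F t₀ ∘ K` and
`F t ∘ K` (`Knot.InGeneralPosition.gaussDiagram`) are relabellings of each other, in both orders:
`F t ∘ K` carries a regular projection reading the diagram of `F t₀ ∘ K`
(`eventually_hasGaussDiagram_map`), and two regular projections of one knot read relabelled
diagrams (`Knot.RegularProjection.isRelabelling_diagram`). GPV (2000), §1.2.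
[cite: GPV2000, §1.2] -/
theorem AmbientIsotopy.eventually_isRelabelling_gaussDiagram (F : AmbientIsotopy (𝓡 3) (𝕊 3))
    (K : Knot) {t₀ : ℝ} (h₀ : Knot.InGeneralPosition (K.map (F.toDiffeomorph t₀))) :
    ∀ᶠ t in 𝓝 t₀, ∀ ht : Knot.InGeneralPosition (K.map (F.toDiffeomorph t)),
      h₀.gaussDiagram.IsRelabelling ht.gaussDiagram ∧
        ht.gaussDiagram.IsRelabelling h₀.gaussDiagram := by
  filter_upwards [F.eventually_hasGaussDiagram_map K h₀.regularProjection] with t ⟨P, hP⟩ ht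
  have h₁ := P.isRelabelling_diagram ht.regularProjection
  have h₂ := ht.regularProjection.isRelabelling_diagram P
  rw [hP] at h₁ h₂
  exact ⟨h₁, h₂⟩

/-- **Path constancy of the Gauss diagram along a generic ambient isotopy.** Let `F` be an
ambient isotopy of `𝕊 3` and `K` a knot such that every moved knot `F t ∘ K`, `t ∈ [a, b]`, is in
general position with respect to the stereographic projection (`Knot.InGeneralPosition`). Then
the Gauss diagrams read off at the two ends (`Knot.InGeneralPosition.gaussDiagram`) differ only by
a renumbering of the chords and a change of base point (`GaussDiagram.IsRelabelling`): the
relation "the read diagrams are relabellings of each other" holds locally on `[a, b]`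
(`eventually_isRelabelling_gaussDiagram`), is transitive (`GaussDiagram.IsRelabelling.trans`),
and `[a, b]` is connected (`IsPreconnected.induction₂'`). Reidemeister (1932), Kap. I §1;
GPV (2000), §1.2. [cite: Reidemeister1932, Kap. I §1] -/
theorem AmbientIsotopy.isRelabelling_gaussDiagram_of_forall_inGeneralPosition
    (F : AmbientIsotopy (𝓡 3) (𝕊 3)) (K : Knot) (a b : ℝ) (hab : a ≤ b)
    (h : ∀ t ∈ Set.Icc a b, Knot.InGeneralPosition (K.map (F.toDiffeomorph t))) :
    (h a ⟨le_rfl, hab⟩).gaussDiagram.IsRelabelling (h b ⟨hab, le_rfl⟩).gaussDiagram := by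
  -- the relation "the diagrams read at times `s` and `t` are relabellings of each other"
  refine isPreconnected_Icc.induction₂' (fun s t ↦
      ∀ (hs : Knot.InGeneralPosition (K.map (F.toDiffeomorph s)))
        (ht : Knot.InGeneralPosition (K.map (F.toDiffeomorph t))),
        hs.gaussDiagram.IsRelabelling ht.gaussDiagram)
    (fun t₀ ht₀ ↦ ?_) (fun x y z _ hy _ hxy hyz hx hz ↦ (hxy hx (h y hy)).trans (hyz (h y hy) hz))
    ⟨le_rfl, hab⟩ ⟨hab, le_rfl⟩ _ _
  filter_upwards [(F.eventually_isRelabelling_gaussDiagram K (h t₀ ht₀)).filter_mono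
    nhdsWithin_le_nhds] with t ht
  exact ⟨fun hs ht' ↦ (ht ht').1, fun ht' hs ↦ (ht ht').2⟩

end Literature.Topology.FourManifolds
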